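import Summits.BirchSwinnertonDyer.BirchSwinnertonDyer.Theorems.PrintCFramBottomClassIndexLawFiveLeHerbrandHomVanishingField
import Literature.NumberTheory.GaloisRepresentations.ArtinFormalismInductionProofs
import HarnessLib

/-!
# Crux `PrintCFram.BottomClassIndexLawFiveLe` (stmt-BirchSwinnertonDyer-20372), line `eisenstein-resource-bdp-line` (v11):
# Stub H′ over ANY number field of degree PRIME TO `p` above the splitting field — the «`p ∤ [L : K]`» descent of the Hom statement

Cell `bsd-print-cfram`, width seat `bsd-line-cfram-p1-w4` (generation g5), `--supports stmt-BirchSwinnertonDyer-20372` (helper);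
sequel of `…HerbrandHomVanishingField.lean` (p652573). THEOREMS ONLY; no definition, no named fact, no `sorry`. BSD is not proved by
any of this; no summit statement is proved by this seat; no stub is closed.

WHY. p652573 reduces v11's Stub H′ (`HerbrandUntwist.stubH_of_forall_hom_of_cmRamified`) to a character statement over a number field
`L` whose absolute Galois group restricts EXACTLY onto `N_θ = ker θ` (the splitting field `K''(θ)`). The Kummer route (w8's
`HerbrandKummer*` chain: `false_of_normalised_kummer_of_classGroupChiComponent_eq_bot` needs `ζ_p ∈ K`) and Leopoldt reflection work
over `L' = L(μ_p)`, and M1 §5 over the compositum with `ℚ(θ)`: fields whose Galois group restricts onto a subgroup of `N_θ` of index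
PRIME TO `p`. Since a homomorphism `N_θ → Φ ≅ ℤ/p` vanishing on a subgroup of index prime to `p` vanishes (its image has order dividing
`p` and dividing the index), the Hom statement descends: this file proves the v11 hypotheses from the character statement over ANY
number field `L/K` with `res(Γ_L) ≤ ker θ` and `p ∤ [L : K]`.

* §1 `apply_eq_zero_of_forall_mem_of_not_dvd_relIndex` — a continuous cocycle `z : N → M` (`N` acting trivially, `#M = p`) vanishing on
  `H ≤ N` with `p ∤ [N : H]` vanishes.
* §2 **`forall_cocycle_ker_eq_zero_of_forall_hom_field_of_not_dvd`** — GENERIC: the LEAD's cocycle statement for `(N_θ, M, S₀, 𝔭)` ⟸ the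
  character statement over `L` (`res(Γ_L) ≤ ker θ`, `p ∤ [L:K]`), local conditions at the primes of `\bar ℤ_L` as in p652573.
* §3 ON THE CLASS: **`homVanishing_sub_of_forall_hom_field_of_not_dvd`**, **`homVanishing_quot_of_forall_hom_field_of_not_dvd`**,
  **`stubH_of_forall_hom_field_of_not_dvd`** (Stub H's two v10 conclusions, via p651343).

References: Greenberg, LNM 1716 §3 («`p ∤ [L_w : K_v]`»); Serre, *Galois Cohomology* I §2.4; Neukirch, *Algebraic Number Theory* IV §1;
Washington §10.2 (reflection over `F(μ_p)`); the LEAD g8 report §4 (crux workfile).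
-/

noncomputable section

-- summit-side namespace `Summit.BirchSwinnertonDyer.BirchSwinnertonDyer.…` (single-conjunct summit, D-0017 layout)
set_option linter.dupNamespace false
set_option autoImplicit false

open scoped Classical Pointwise
open NumberField WeierstrassCurve IsDedekindDomain Field
open Literature.NumberTheory.EllipticCurves
open Literature.NumberTheory.EllipticCurves.GreenbergSelmer
open Literature.NumberTheory.EllipticCurves.GreenbergVatsal2000
open Literature.NumberTheory.GaloisRepresentations
open Summit.BirchSwinnertonDyer.Rank1Residual
open Summit.BirchSwinnertonDyer.Rank1Residual.X11b

namespace Summit.BirchSwinnertonDyer.BirchSwinnertonDyer.Theorems.PrintCFram.HerbrandSelmerToHom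

/-! ## §1 Homomorphisms to a group of prime order vanishing on a subgroup of index prime to `p` -/

section Index

variable {G : Type} [Group G] [TopologicalSpace G] [IsTopologicalGroup G] {p : ℕ} [hp : Fact p.Prime]
variable {M : Type} [AddCommGroup M] [DistribMulAction G M] [TopologicalSpace M] [DiscreteTopology M]

omit [IsTopologicalGroup G] in
/-- **A cocycle (= homomorphism, trivial action) with values in a group of prime order `p` which vanishes on a subgroup `H ≤ N` of
index prime to `p` vanishes on `N`**: its kernel `K_z` contains `H`, so `[N : K_z]` divides `[N : H]`; and `[N : K_z] = #z(N)` divides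
`#M = p`. [cite: SerreGaloisCohomology1997, I §2.4] -/
theorem apply_eq_zero_of_forall_mem_of_not_dvd_relIndex {N : Subgroup G} (htriv : ∀ (n : N) (m : M), n • m = m)
    (hcard : Nat.card M = p) (z : contOneCocycles (discreteTopRep N M)) {H : Subgroup G} (hHN : H ≤ N)
    (hH : ∀ g : G, ∀ hg : g ∈ H, z.1 ⟨g, hHN hg⟩ = 0) (hidx : ¬ p ∣ H.relIndex N) (n : N) : z.1 n = 0 := by
  -- the homomorphism `ẑ : N → Multiplicative M` and its kernel
  let zh : N →* Multiplicative M :=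
    MonoidHom.mk' (fun n ↦ Multiplicative.ofAdd (z.1 n)) (fun a b ↦ by rw [cocycle_map_mul_of_trivial htriv, ofAdd_add])
  have hzh : ∀ n : N, zh n = Multiplicative.ofAdd (z.1 n) := fun n ↦ rfl
  have hmem : ∀ n : N, n ∈ zh.ker ↔ z.1 n = 0 := fun n ↦ by
    rw [MonoidHom.mem_ker, hzh]
    exact ⟨fun h ↦ Multiplicative.ofAdd.injective (h.trans ofAdd_zero.symm), fun h ↦ by rw [h, ofAdd_zero]⟩
  -- `H ≤ ker ẑ` inside `N`
  have hle : H.subgroupOf N ≤ zh.ker := fun n hn ↦ (hmem n).2 (by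
    have h := hH (n : G) (Subgroup.mem_subgroupOf.1 hn)
    have e : (⟨(n : G), hHN (Subgroup.mem_subgroupOf.1 hn)⟩ : N) = n := Subtype.ext rfl
    rwa [e] at h)
  -- `[N : ker ẑ] ∣ [N : H]` and `[N : ker ẑ] = #range ∣ p`
  have h1 : zh.ker.index ∣ H.relIndex N := Subgroup.index_dvd_of_le hle
  have h2 : zh.ker.index ∣ p := by
    have hM : Nat.card (Multiplicative M) = p := hcard
    rw [Subgroup.index_ker, ← hM]
    exact Subgroup.card_subgroup_dvd_card zh.range
  have hone : zh.ker.index = 1 := by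
    have hdvd : zh.ker.index ∣ Nat.gcd p (H.relIndex N) := Nat.dvd_gcd h2 h1
    have hg : Nat.gcd p (H.relIndex N) = 1 := ((Nat.Prime.coprime_iff_not_dvd hp.out).2 hidx).gcd_eq_one
    rw [hg] at hdvd
    exact Nat.dvd_one.mp hdvd
  have htop : zh.ker = ⊤ := Subgroup.index_eq_one.mp hone
  exact (hmem n).1 (htop ▸ Subgroup.mem_top n)

end Index

/-! ## §2 The LEAD's cocycle statement from the character statement over `L`, `res(Γ_L) ≤ N_θ` of index prime to `p` -/

section Field

variable {K : Type} [Field K] [NumberField K] {p : ℕ} [hp : Fact p.Prime]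
variable {M : Type} [AddCommGroup M] [DistribMulAction (absoluteGaloisGroup K) M] [TopologicalSpace M] [DiscreteTopology M]
variable {L : Type} [Field L] [NumberField L] [Algebra K L]

omit hp in
/-- `[ker θ : res(Γ_L)]` is prime to `p` when `p ∤ [L : K]` (`[Γ_K : res(Γ_L)] = [L : K]`, tree `index_range_absGaloisRestrict_eq_finrank`).
[cite: NeukirchANT1999, Ch. IV §1] -/
theorem not_dvd_relIndex_range_of_not_dvd_finrank (N : Subgroup (absoluteGaloisGroup K)) (hle : (absGaloisRestrict K L).range ≤ N)
    (hdeg : ¬ p ∣ Module.finrank K L) : ¬ p ∣ (absGaloisRestrict K L).range.relIndex N := by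
  haveI : FiniteDimensional K L := Module.Finite.of_restrictScalars_finite ℚ K L
  intro h
  apply hdeg
  rw [← index_range_absGaloisRestrict_eq_finrank K L, ← Subgroup.relIndex_mul_index hle]
  exact Dvd.dvd.mul_right h _

/-- **The v11 Hom statement ⟸ the character statement over ANY `L/K` with `res(Γ_L) ≤ ker θ` and `p ∤ [L : K]`** (e.g. `L = K(Φ)(μ_p)`,
or the compositum with `ℚ(θ)` of M1 §5). As `forall_cocycle_ker_eq_zero_of_forall_hom_field` (p652573), with the equality
`res(Γ_L) = ker θ` weakened to an inclusion of index prime to `p`: the transported character `φ = e ∘ z ∘ res` vanishes by hypothesis, so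
`z` vanishes on `res(Γ_L)`, a subgroup of `N_θ` of index dividing `[L:K]`, hence on `N_θ` (§1). [cite: GreenbergLNM1716, §3 (PDF p. 86)]
[cite: NeukirchANT1999, Ch. IV §1] [cite: SerreGaloisCohomology1997, I §2.4] -/
theorem forall_cocycle_ker_eq_zero_of_forall_hom_field_of_not_dvd (hcard : Nat.card M = p)
    (θ : absoluteGaloisGroup K →* (ZMod p)ˣ)
    (hθ : ∀ (g : absoluteGaloisGroup K) (m : M), g • m = (((θ g : ZMod p).val : ℕ) : ℤ) • m)
    (hker : ∀ g : absoluteGaloisGroup K, θ g = 1 ↔ ∀ m : M, g • m = m)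
    (hL : ∀ g : absoluteGaloisGroup K, g ∈ (absGaloisRestrict K L).range → θ g = 1) (hdeg : ¬ p ∣ Module.finrank K L)
    (𝔭 : HeightOneSpectrum (𝓞 K)) (S₀ : Set (HeightOneSpectrum (𝓞 K)))
    (hhom : ∀ φ : absoluteGaloisGroup L → ZMod p, Continuous φ →
      (∀ a b : absoluteGaloisGroup L, φ (a * b) = φ a + φ b) →
      (∀ (σ : absoluteGaloisGroup K) (τ τ' : absoluteGaloisGroup L),
        absGaloisRestrict K L τ' = σ * absGaloisRestrict K L τ * σ⁻¹ → φ τ' = (θ σ : ZMod p) * φ τ) →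
      (∀ v : HeightOneSpectrum (𝓞 K), v ∉ S₀ → ((p : ℕ) : 𝓞 K) ∉ v.asIdeal →
        ∀ u : HeightOneSpectrum (𝓞 L), u.asIdeal.under (𝓞 K) = v.asIdeal →
          ∀ 𝔔 ∈ u.primesAbove, ∀ τ ∈ 𝔔.inertia (absoluteGaloisGroup L), φ τ = 0) →
      (∀ u : HeightOneSpectrum (𝓞 L), u.asIdeal.under (𝓞 K) = 𝔭.asIdeal →
          ∀ 𝔔 ∈ u.primesAbove, ∀ τ ∈ 𝔔.decompositionSubgroup (absoluteGaloisGroup L), φ τ = 0) →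
      ∀ τ : absoluteGaloisGroup L, φ τ = 0)
    (z : contOneCocycles (discreteTopRep (MulAction.toPermHom (absoluteGaloisGroup K) M).ker M))
    (hinv : ∀ (g : absoluteGaloisGroup K) (n : (MulAction.toPermHom (absoluteGaloisGroup K) M).ker),
      g • z.1 (subgroupConj _ g n) = z.1 n)
    (hunr : ∀ v : HeightOneSpectrum (𝓞 K), v ∉ S₀ → ((p : ℕ) : 𝓞 K) ∉ v.asIdeal →
      ∀ x : inertiaIn (MulAction.toPermHom (absoluteGaloisGroup K) M).ker v, z.1 (inertiaInToH _ v x) = 0)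
    (hstr : ∀ x : decompIn (MulAction.toPermHom (absoluteGaloisGroup K) M).ker 𝔭, z.1 (decompInToH _ 𝔭 x) = 0)
    (n : (MulAction.toPermHom (absoluteGaloisGroup K) M).ker) : z.1 n = 0 := by
  -- `res(Γ_L) ≤ N`
  have hresN : ∀ τ : absoluteGaloisGroup L,
      absGaloisRestrict K L τ ∈ (MulAction.toPermHom (absoluteGaloisGroup K) M).ker := fun τ ↦
    (mem_ker_toPermHom_iff' (M := M) _).2 ((hker _).1 (hL _ ⟨τ, rfl⟩))
  have hleN : (absGaloisRestrict K L).range ≤ (MulAction.toPermHom (absoluteGaloisGroup K) M).ker := by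
    rintro _ ⟨τ, rfl⟩; exact hresN τ
  have htriv : ∀ (m : (MulAction.toPermHom (absoluteGaloisGroup K) M).ker) (x : M), m • x = x := fun m x ↦
    (mem_ker_toPermHom_iff' (M := M) (m : absoluteGaloisGroup K)).1 m.2 x
  -- transport along `M ≃+ ℤ/p` and `res`
  haveI : IsAddCyclic M := isAddCyclic_of_prime_card hcard
  let e : M ≃+ ZMod p := addEquivOfAddCyclicCardEq (by rw [hcard, Nat.card_zmod])
  let φ : absoluteGaloisGroup L → ZMod p := fun τ ↦ e (z.1 ⟨absGaloisRestrict K L τ, hresN τ⟩)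
  have hφc : Continuous φ :=
    continuous_of_discreteTopology.comp (z.1.continuous.comp ((absGaloisRestrict K L).continuous.subtype_mk _))
  have key := hhom φ hφc
    (fun a b ↦ by
      change e (z.1 ⟨_, _⟩) = e (z.1 ⟨_, _⟩) + e (z.1 ⟨_, _⟩)
      rw [← map_add]
      congr 1
      have hmul : (⟨absGaloisRestrict K L (a * b), hresN (a * b)⟩ : (MulAction.toPermHom (absoluteGaloisGroup K) M).ker) =
          ⟨absGaloisRestrict K L a, hresN a⟩ * ⟨absGaloisRestrict K L b, hresN b⟩ := Subtype.ext (map_mul _ a b)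
      rw [hmul, cocycle_map_mul_of_trivial htriv])
    (fun σ τ τ' h ↦ by
      change e (z.1 ⟨_, _⟩) = (θ σ : ZMod p) * e (z.1 ⟨_, _⟩)
      have hconj : (⟨absGaloisRestrict K L τ', hresN τ'⟩ : (MulAction.toPermHom (absoluteGaloisGroup K) M).ker) =
          ⟨σ * (absGaloisRestrict K L τ) * σ⁻¹, Subgroup.Normal.conj_mem inferInstance _ (hresN τ) σ⟩ := Subtype.ext h
      rw [hconj, apply_conj_eq_smul_of_invariant z hinv σ ⟨absGaloisRestrict K L τ, hresN τ⟩, hθ σ, map_zsmul, zsmul_eq_mul,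
        Int.cast_natCast, ZMod.natCast_zmod_val])
    (fun v hv hpv u hu 𝔔 h𝔔 τ hτ ↦ by
      change e (z.1 ⟨_, _⟩) = 0
      rw [apply_eq_zero_of_mem_primesAbove_inertia z hinv (hunr v hv hpv) (comap_absIntegersMap_mem_primesAbove hu h𝔔)
        ⟨absGaloisRestrict K L τ, hresN τ⟩ ((mem_inertia_iff_absGaloisRestrict_mem 𝔔 τ).1 hτ), map_zero])
    (fun u hu 𝔔 h𝔔 τ hτ ↦ by
      change e (z.1 ⟨_, _⟩) = 0
      rw [apply_eq_zero_of_mem_primesAbove_decompositionSubgroup z hinv hstr (comap_absIntegersMap_mem_primesAbove hu h𝔔)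
        ⟨absGaloisRestrict K L τ, hresN τ⟩ ((mem_decompositionSubgroup_iff_absGaloisRestrict_mem 𝔔 τ).1 hτ), map_zero])
  -- `z` vanishes on `res(Γ_L)`, a subgroup of `N` of index prime to `p`, hence on `N`
  refine apply_eq_zero_of_forall_mem_of_not_dvd_relIndex htriv hcard z hleN ?_
    (not_dvd_relIndex_range_of_not_dvd_finrank _ hleN hdeg) n
  rintro _ ⟨τ, rfl⟩
  exact e.map_eq_zero_iff.1 (key τ)

end Field

/-! ## §3 On the class: the hypotheses of `HerbrandUntwist.stubH_of_forall_hom_of_cmRamified` over `L` of degree prime to `p` -/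

section Class

variable {p : ℕ} [hp : Fact p.Prime]

/-- **v11 Stub H, `Φ`-conjunct, over any `L/K` with `res(Γ_L) ≤ ker θ_Φ` and `p ∤ [L:K]`** (e.g. `K(Φ)(μ_p)`): the LEAD's Hom statement for
`(N_θ, Φ)` from the character statement over `L`. [cite: GreenbergLNM1716, §3 (PDF p. 86)] [cite: NeukirchANT1999, Ch. IV §1] -/
theorem homVanishing_sub_of_forall_hom_field_of_not_dvd (W : WeierstrassCurve ℚ) (K : Type) [Field K] [NumberField K]
    (𝔭 : HeightOneSpectrum (𝓞 K)) (S : Set (HeightOneSpectrum (𝓞 K)))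
    (Φ : X2.ResidualDevissageModules.StableSubgroup (absoluteGaloisGroup K) ((W.baseChange K).geomTorsion (p : ℤ)))
    (hcard : Nat.card Φ.Sub = p) (θ : absoluteGaloisGroup K →* (ZMod p)ˣ)
    (hθ : ∀ (g : absoluteGaloisGroup K) (x : Φ.Sub), g • x = (((θ g : ZMod p).val : ℕ) : ℤ) • x)
    (hker : ∀ g : absoluteGaloisGroup K, θ g = 1 ↔ ∀ x : Φ.Sub, g • x = x)
    (L : Type) [Field L] [NumberField L] [Algebra K L]
    (hL : ∀ g : absoluteGaloisGroup K, g ∈ (absGaloisRestrict K L).range → θ g = 1) (hdeg : ¬ p ∣ Module.finrank K L)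
    (hhom : ∀ φ : absoluteGaloisGroup L → ZMod p, Continuous φ →
      (∀ a b : absoluteGaloisGroup L, φ (a * b) = φ a + φ b) →
      (∀ (σ : absoluteGaloisGroup K) (τ τ' : absoluteGaloisGroup L),
        absGaloisRestrict K L τ' = σ * absGaloisRestrict K L τ * σ⁻¹ → φ τ' = (θ σ : ZMod p) * φ τ) →
      (∀ v : HeightOneSpectrum (𝓞 K), v ∉ S → ((p : ℕ) : 𝓞 K) ∉ v.asIdeal →
        ∀ u : HeightOneSpectrum (𝓞 L), u.asIdeal.under (𝓞 K) = v.asIdeal →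
          ∀ 𝔔 ∈ u.primesAbove, ∀ τ ∈ 𝔔.inertia (absoluteGaloisGroup L), φ τ = 0) →
      (∀ u : HeightOneSpectrum (𝓞 L), u.asIdeal.under (𝓞 K) = 𝔭.asIdeal →
          ∀ 𝔔 ∈ u.primesAbove, ∀ τ ∈ 𝔔.decompositionSubgroup (absoluteGaloisGroup L), φ τ = 0) →
      ∀ τ : absoluteGaloisGroup L, φ τ = 0) :
    ∀ z : contOneCocycles (discreteTopRep (MulAction.toPermHom (absoluteGaloisGroup K) Φ.Sub).ker Φ.Sub),
      (∀ (g : absoluteGaloisGroup K) (n : (MulAction.toPermHom (absoluteGaloisGroup K) Φ.Sub).ker),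
        g • z.1 (subgroupConj _ g n) = z.1 n) →
      (∀ v : HeightOneSpectrum (𝓞 K), v ∉ S → ((p : ℕ) : 𝓞 K) ∉ v.asIdeal →
        ∀ x : inertiaIn (MulAction.toPermHom (absoluteGaloisGroup K) Φ.Sub).ker v, z.1 (inertiaInToH _ v x) = 0) →
      (∀ x : decompIn (MulAction.toPermHom (absoluteGaloisGroup K) Φ.Sub).ker 𝔭, z.1 (decompInToH _ 𝔭 x) = 0) →
      ∀ n, z.1 n = 0 :=
  fun z hinv hunr hstr n ↦
    forall_cocycle_ker_eq_zero_of_forall_hom_field_of_not_dvd hcard θ hθ hker hL hdeg 𝔭 S hhom z hinv hunr hstr n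

/-- **v11 Stub H, `W[p]/Φ`-conjunct, over any `L'/K` with `res(Γ_{L'}) ≤ ker θ'` and `p ∤ [L':K]`.** [cite: GreenbergLNM1716, §3 (PDF p. 86)]
[cite: NeukirchANT1999, Ch. IV §1] -/
theorem homVanishing_quot_of_forall_hom_field_of_not_dvd (W : WeierstrassCurve ℚ) (K : Type) [Field K] [NumberField K]
    [(W.baseChange K).IsElliptic] (𝔭 : HeightOneSpectrum (𝓞 K)) (S : Set (HeightOneSpectrum (𝓞 K)))
    (Φ : X2.ResidualDevissageModules.StableSubgroup (absoluteGaloisGroup K) ((W.baseChange K).geomTorsion (p : ℤ)))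
    (hcard : Nat.card Φ.Sub = p) (θ' : absoluteGaloisGroup K →* (ZMod p)ˣ)
    (hθ' : ∀ (g : absoluteGaloisGroup K) (y : Φ.Quot), g • y = (((θ' g : ZMod p).val : ℕ) : ℤ) • y)
    (hker' : ∀ g : absoluteGaloisGroup K, θ' g = 1 ↔ ∀ y : Φ.Quot, g • y = y)
    (L' : Type) [Field L'] [NumberField L'] [Algebra K L']
    (hL' : ∀ g : absoluteGaloisGroup K, g ∈ (absGaloisRestrict K L').range → θ' g = 1) (hdeg' : ¬ p ∣ Module.finrank K L')
    (hhom : ∀ φ : absoluteGaloisGroup L' → ZMod p, Continuous φ →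
      (∀ a b : absoluteGaloisGroup L', φ (a * b) = φ a + φ b) →
      (∀ (σ : absoluteGaloisGroup K) (τ τ' : absoluteGaloisGroup L'),
        absGaloisRestrict K L' τ' = σ * absGaloisRestrict K L' τ * σ⁻¹ → φ τ' = (θ' σ : ZMod p) * φ τ) →
      (∀ v : HeightOneSpectrum (𝓞 K), v ∉ S → ((p : ℕ) : 𝓞 K) ∉ v.asIdeal →
        ∀ u : HeightOneSpectrum (𝓞 L'), u.asIdeal.under (𝓞 K) = v.asIdeal →
          ∀ 𝔔 ∈ u.primesAbove, ∀ τ ∈ 𝔔.inertia (absoluteGaloisGroup L'), φ τ = 0) →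
      (∀ u : HeightOneSpectrum (𝓞 L'), u.asIdeal.under (𝓞 K) = 𝔭.asIdeal →
          ∀ 𝔔 ∈ u.primesAbove, ∀ τ ∈ 𝔔.decompositionSubgroup (absoluteGaloisGroup L'), φ τ = 0) →
      ∀ τ : absoluteGaloisGroup L', φ τ = 0) :
    ∀ z : contOneCocycles (discreteTopRep (MulAction.toPermHom (absoluteGaloisGroup K) Φ.Quot).ker Φ.Quot),
      (∀ (g : absoluteGaloisGroup K) (n : (MulAction.toPermHom (absoluteGaloisGroup K) Φ.Quot).ker),
        g • z.1 (subgroupConj _ g n) = z.1 n) →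
      (∀ v : HeightOneSpectrum (𝓞 K), v ∉ S → ((p : ℕ) : 𝓞 K) ∉ v.asIdeal →
        ∀ x : inertiaIn (MulAction.toPermHom (absoluteGaloisGroup K) Φ.Quot).ker v, z.1 (inertiaInToH _ v x) = 0) →
      (∀ x : decompIn (MulAction.toPermHom (absoluteGaloisGroup K) Φ.Quot).ker 𝔭, z.1 (decompInToH _ 𝔭 x) = 0) →
      ∀ n, z.1 n = 0 :=
  fun z hinv hunr hstr n ↦
    forall_cocycle_ker_eq_zero_of_forall_hom_field_of_not_dvd
      (HerbrandLineRestriction.natCard_quot_eq_of_card_sub (W.baseChange K) Φ hcard) θ' hθ' hker' hL' hdeg' 𝔭 S hhom z hinv hunr hstr n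

/-- **Stub H (v10's two conclusions) from the two character statements over `L`, `L'` of degree prime to `p`** with `res(Γ_L) ≤ ker θ`,
`res(Γ_{L'}) ≤ ker θ'` (via LEAD g8's p651343). [cite: GreenbergLNM1716, §3 (PDF p. 86)] [cite: KrizLi2019, p. 3 («relative p-class numbers»)]
[cite: NeukirchANT1999, Ch. IV §1] -/
theorem stubH_of_forall_hom_field_of_not_dvd (W : WeierstrassCurve ℚ) [W.IsElliptic] (hCM : W.HasCM)
    (hram : Rank1Residual.CMRamified W p) (h5 : 5 ≤ p) (K : Type) [Field K] [NumberField K] (hK2 : Module.finrank ℚ K = 2)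
    (κ : ZpExtension K p) (𝔭 : HeightOneSpectrum (𝓞 K)) (h𝔭 : ((p : ℕ) : 𝓞 K) ∈ 𝔭.asIdeal)
    (S : Set (HeightOneSpectrum (𝓞 K)))
    (Φ : X2.ResidualDevissageModules.StableSubgroup (absoluteGaloisGroup K) ((W.baseChange K).geomTorsion (p : ℤ)))
    (hcard : Nat.card Φ.Sub = p)
    (θ : absoluteGaloisGroup K →* (ZMod p)ˣ)
    (hθ : ∀ (g : absoluteGaloisGroup K) (x : Φ.Sub), g • x = (((θ g : ZMod p).val : ℕ) : ℤ) • x)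
    (hker : ∀ g : absoluteGaloisGroup K, θ g = 1 ↔ ∀ x : Φ.Sub, g • x = x)
    (L : Type) [Field L] [NumberField L] [Algebra K L]
    (hL : ∀ g : absoluteGaloisGroup K, g ∈ (absGaloisRestrict K L).range → θ g = 1) (hdeg : ¬ p ∣ Module.finrank K L)
    (hhomS : ∀ φ : absoluteGaloisGroup L → ZMod p, Continuous φ →
      (∀ a b : absoluteGaloisGroup L, φ (a * b) = φ a + φ b) →
      (∀ (σ : absoluteGaloisGroup K) (τ τ' : absoluteGaloisGroup L),
        absGaloisRestrict K L τ' = σ * absGaloisRestrict K L τ * σ⁻¹ → φ τ' = (θ σ : ZMod p) * φ τ) →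
      (∀ v : HeightOneSpectrum (𝓞 K), v ∉ S → ((p : ℕ) : 𝓞 K) ∉ v.asIdeal →
        ∀ u : HeightOneSpectrum (𝓞 L), u.asIdeal.under (𝓞 K) = v.asIdeal →
          ∀ 𝔔 ∈ u.primesAbove, ∀ τ ∈ 𝔔.inertia (absoluteGaloisGroup L), φ τ = 0) →
      (∀ u : HeightOneSpectrum (𝓞 L), u.asIdeal.under (𝓞 K) = 𝔭.asIdeal →
          ∀ 𝔔 ∈ u.primesAbove, ∀ τ ∈ 𝔔.decompositionSubgroup (absoluteGaloisGroup L), φ τ = 0) →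
      ∀ τ : absoluteGaloisGroup L, φ τ = 0)
    (θ' : absoluteGaloisGroup K →* (ZMod p)ˣ)
    (hθ' : ∀ (g : absoluteGaloisGroup K) (y : Φ.Quot), g • y = (((θ' g : ZMod p).val : ℕ) : ℤ) • y)
    (hker' : ∀ g : absoluteGaloisGroup K, θ' g = 1 ↔ ∀ y : Φ.Quot, g • y = y)
    (L' : Type) [Field L'] [NumberField L'] [Algebra K L']
    (hL' : ∀ g : absoluteGaloisGroup K, g ∈ (absGaloisRestrict K L').range → θ' g = 1) (hdeg' : ¬ p ∣ Module.finrank K L')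
    (hhomQ : ∀ φ : absoluteGaloisGroup L' → ZMod p, Continuous φ →
      (∀ a b : absoluteGaloisGroup L', φ (a * b) = φ a + φ b) →
      (∀ (σ : absoluteGaloisGroup K) (τ τ' : absoluteGaloisGroup L'),
        absGaloisRestrict K L' τ' = σ * absGaloisRestrict K L' τ * σ⁻¹ → φ τ' = (θ' σ : ZMod p) * φ τ) →
      (∀ v : HeightOneSpectrum (𝓞 K), v ∉ S → ((p : ℕ) : 𝓞 K) ∉ v.asIdeal →
        ∀ u : HeightOneSpectrum (𝓞 L'), u.asIdeal.under (𝓞 K) = v.asIdeal →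
          ∀ 𝔔 ∈ u.primesAbove, ∀ τ ∈ 𝔔.inertia (absoluteGaloisGroup L'), φ τ = 0) →
      (∀ u : HeightOneSpectrum (𝓞 L'), u.asIdeal.under (𝓞 K) = 𝔭.asIdeal →
          ∀ 𝔔 ∈ u.primesAbove, ∀ τ ∈ 𝔔.decompositionSubgroup (absoluteGaloisGroup L'), φ τ = 0) →
      ∀ τ : absoluteGaloisGroup L', φ τ = 0) :
    datumStrictSelmer (κ.layerSubgroup 0) Φ.Sub p (AcSelmer.bdpData Φ.Sub p 𝔭) S = ⊥ ∧
      datumStrictSelmer (κ.layerSubgroup 0) Φ.Quot p (AcSelmer.bdpData Φ.Quot p 𝔭) S = ⊥ := by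
  haveI hE : (W.baseChange K).IsElliptic := by unfold WeierstrassCurve.baseChange; infer_instance
  exact HerbrandUntwist.stubH_of_forall_hom_of_cmRamified W hCM hram h5 K hK2 κ 𝔭 h𝔭 S Φ hcard
    (homVanishing_sub_of_forall_hom_field_of_not_dvd W K 𝔭 S Φ hcard θ hθ hker L hL hdeg hhomS)
    (homVanishing_quot_of_forall_hom_field_of_not_dvd W K 𝔭 S Φ hcard θ' hθ' hker' L' hL' hdeg' hhomQ)

end Class

end Summit.BirchSwinnertonDyer.BirchSwinnertonDyer.Theorems.PrintCFram.HerbrandSelmerToHom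

end
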